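import Literature.NumberTheory.EllipticCurves.NeronModelLocal
import HarnessLib

/-!
# Schematic Néron models: transport lemmas, and pushouts of schemes along open immersions

Fourth infrastructure file of the existence programme for Néron models
(`Literature.NumberTheory.EllipticCurves.NeronModelExistence`; see `NeronModelBaseChange`,
`NeronModelGroupStructure`, `NeronModelLocal`, `NeronModelGluing`), collecting what the proof of
the two-open-sets gluing fact (`NeronModelTwoOpens`) needs besides the local nature of the Néron
property:

* transport of the group-free notion `IsSchematicNeronModel` (of `NeronModelGroupStructure`)
  along isomorphisms of `R`-schemes (`IsSchematicNeronModel.of_iso_left`), along restriction to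
  an open subscheme of the base (`IsSchematicNeronModel.pullback_specOfAlgebraMap`, the group-free
  `IsNeronModel.pullback_specOfAlgebraMap`), and between two models `R₁ ≅ R₂` of the same
  localization `R[1/x]` (`IsSchematicNeronModel.of_isLocalization_away`);
* the two charts of a pushout `A ⨿_U B` of schemes along open immersions (Mathlib: a locally
  directed colimit, `AlgebraicGeometry.Scheme.IsLocallyDirected`; the charts are open
  immersions, `Scheme.IsLocallyDirected.instIsOpenImmersionι`) jointly cover it, and a criterion computing the preimage of an open subset of a base `S` under
  `A ⨿_U B → S` as one of the charts (`preimage_desc_eq_range_inl` / `_inr`);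
* the image of `Spec R[1/x] → Spec R` is `D(x)` (`range_specOfAlgebraMap`, Mathlib
  `PrimeSpectrum.localization_away_comap_range`).

Everything here is standard scheme theory (EGA I / the Stacks project, Tags 01JA–01JD on gluing
and 01LH on relative gluing); no named facts are introduced.

## References

* The Stacks project, Tags 01JA (gluing schemes), 01LH (relative gluing). [StacksProject]
* S. Bosch, W. Lütkebohmert, M. Raynaud, *Néron Models*, Springer 1990, §1.2. [BLRNeronModels1990]
-/

noncomputable section

universe u

namespace Literature.NumberTheory.EllipticCurves

open AlgebraicGeometry CategoryTheory Limits
open scoped CategoryTheory.Obj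

section Transport

variable {R : Type u} [CommRing R] {K : Type u} [Field K] [Algebra R K]
  {𝒩 : Over (Spec (.of R))} {E : Over (Spec (.of K))}

/-- Bijectivity of `f ↦ (base change of f along a)` on `Hom_S(𝒴, 𝒩)` is invariant under
isomorphisms of the target `𝒩`. [folklore] -/
theorem bijective_map_iff_of_iso_target {S T : Scheme.{u}} (a : T ⟶ S) (𝒴 : Over S)
    {𝒩₁ 𝒩₂ : Over S} (e : 𝒩₁ ≅ 𝒩₂) :
    (Function.Bijective fun f : 𝒴 ⟶ 𝒩₁ => (Over.pullback a).map f) ↔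
      Function.Bijective fun f : 𝒴 ⟶ 𝒩₂ => (Over.pullback a).map f := by
  have hfun : (fun f : 𝒴 ⟶ 𝒩₂ => (Over.pullback a).map f) =
      (Iso.homCongr (Iso.refl _) ((Over.pullback a).mapIso e)) ∘
        (fun f : 𝒴 ⟶ 𝒩₁ => (Over.pullback a).map f) ∘ (Iso.homCongr (Iso.refl _) e.symm) := by
    funext f
    simp [Iso.homCongr_apply, ← Functor.map_comp]
  rw [hfun, Function.Bijective.of_comp_iff' (Equiv.bijective _),
    Function.Bijective.of_comp_iff _ (Equiv.bijective _)]

namespace IsSchematicNeronModel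

/-- Being a schematic Néron model is invariant under isomorphisms of `R`-schemes. [folklore] -/
theorem of_iso_left (h : IsSchematicNeronModel R K 𝒩 E) {𝒩' : Over (Spec (.of R))} (e : 𝒩 ≅ 𝒩') :
    IsSchematicNeronModel R K 𝒩' E := by
  have hhom : 𝒩'.hom = e.inv.left ≫ 𝒩.hom := (Over.w e.inv).symm
  refine ⟨?_, ?_, ?_, ?_, ?_, ?_⟩
  · rw [hhom]
    exact (MorphismProperty.cancel_left_of_respectsIso @Smooth _ _).mpr h.smooth
  · rw [hhom]
    exact (MorphismProperty.cancel_left_of_respectsIso @IsSeparated _ _).mpr h.isSeparated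
  · rw [hhom]
    exact (MorphismProperty.cancel_left_of_respectsIso @LocallyOfFiniteType _ _).mpr
      h.locallyOfFiniteType
  · rw [hhom]
    exact (MorphismProperty.cancel_left_of_respectsIso @QuasiCompact _ _).mpr h.quasiCompact
  · obtain ⟨e₀⟩ := h.nonempty_iso
    exact ⟨((genericFibre R K).mapIso e).symm ≪≫ e₀⟩
  · intro 𝒳 h𝒳
    exact (bijective_map_iff_of_iso_target _ _ e).mp (h.mappingProperty 𝒳 h𝒳)

/-- If `𝒩_K ≅ E`, then `(𝒩 ×_S S')_T ≅ E` for `a = a' ≫ φ` (transitivity of base change).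
[folklore] -/
theorem _root_.Literature.NumberTheory.EllipticCurves.nonempty_iso_pullback_pullback
    {S S' T : Scheme.{u}} (φ : S' ⟶ S) (a' : T ⟶ S') {a : T ⟶ S} (ha : a' ≫ φ = a) (𝒩 : Over S)
    (E : Over T) (H : Nonempty ((Over.pullback a).obj 𝒩 ≅ E)) :
    Nonempty ((Over.pullback a').obj ((Over.pullback φ).obj 𝒩) ≅ E) := by
  subst ha
  exact ⟨pullbackPullbackIso φ a' 𝒩 ≪≫ H.some⟩

variable {R' : Type u} [CommRing R'] [Algebra R R'] [Algebra R' K] [IsScalarTower R R' K]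

/-- **Schematic Néron models restrict to open subschemes of the base** (group-free version of
`IsNeronModel.pullback_specOfAlgebraMap` of `NeronModelBaseChange`, same proof). [folklore] -/
theorem pullback_specOfAlgebraMap [IsOpenImmersion (specOfAlgebraMap R R')]
    (h : IsSchematicNeronModel R K 𝒩 E) :
    IsSchematicNeronModel R' K ((Over.pullback (specOfAlgebraMap R R')).obj 𝒩) E where
  smooth := by
    change Smooth (pullback.snd 𝒩.hom (specOfAlgebraMap R R'))
    exact MorphismProperty.pullback_snd _ _ h.smooth
  isSeparated := by
    change IsSeparated (pullback.snd 𝒩.hom (specOfAlgebraMap R R'))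
    exact MorphismProperty.pullback_snd _ _ h.isSeparated
  locallyOfFiniteType := by
    change LocallyOfFiniteType (pullback.snd 𝒩.hom (specOfAlgebraMap R R'))
    exact MorphismProperty.pullback_snd _ _ h.locallyOfFiniteType
  quasiCompact := by
    change QuasiCompact (pullback.snd 𝒩.hom (specOfAlgebraMap R R'))
    exact MorphismProperty.pullback_snd _ _ h.quasiCompact
  nonempty_iso := nonempty_iso_pullback_pullback (specOfAlgebraMap R R') (specGenericPoint R' K)
    (specGenericPoint_comp_specOfAlgebraMap R K R') 𝒩 E h.nonempty_iso
  mappingProperty 𝒳' h𝒳' := by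
    have hsm : Smooth ((Over.map (specOfAlgebraMap R R')).obj 𝒳').hom := by
      change Smooth (𝒳'.hom ≫ specOfAlgebraMap R R')
      exact MorphismProperty.comp_mem _ _ _ h𝒳' inferInstance
    exact bijective_map_pullback (specOfAlgebraMap R R') (specGenericPoint R' K)
      (specGenericPoint_comp_specOfAlgebraMap R K R') 𝒩 𝒳' (h.mappingProperty _ hsm)

/-- **Independence of the model.** If `𝒩 ×_R R₁` is a schematic Néron model of `E` over one
`R`-algebra model `R₁` of `R[1/x]`, then `𝒩 ×_R R₂` is one over any other model `R₂` (the
models are isomorphic over `R`, compatibly with their maps to `K`). [folklore] -/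
theorem of_isLocalization_away (x : R) (R₁ R₂ : Type u) [CommRing R₁] [CommRing R₂]
    [Algebra R R₁] [Algebra R R₂] [IsLocalization.Away x R₁] [IsLocalization.Away x R₂]
    [Algebra R₁ K] [Algebra R₂ K] [IsScalarTower R R₁ K] [IsScalarTower R R₂ K]
    (h : IsSchematicNeronModel R₁ K ((Over.pullback (specOfAlgebraMap R R₁)).obj 𝒩) E) :
    IsSchematicNeronModel R₂ K ((Over.pullback (specOfAlgebraMap R R₂)).obj 𝒩) E := by
  let e : R₁ ≃ₐ[R] R₂ := IsLocalization.algEquiv (Submonoid.powers x) R₁ R₂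
  letI : Algebra R₁ R₂ := e.toAlgHom.toRingHom.toAlgebra
  haveI : IsScalarTower R R₁ R₂ := IsScalarTower.of_algebraMap_eq fun r => (e.commutes r).symm
  haveI : IsScalarTower R₁ R₂ K := by
    refine IsScalarTower.of_algebraMap_eq' ?_
    apply IsLocalization.ringHom_ext (Submonoid.powers x)
    rw [RingHom.comp_assoc, ← IsScalarTower.algebraMap_eq R R₁ R₂, ← IsScalarTower.algebraMap_eq,
      ← IsScalarTower.algebraMap_eq]
  haveI : IsLocalization.Away (1 : R₁) R₂ :=
    IsLocalization.away_of_isUnit_of_bijective R₂ isUnit_one e.bijective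
  haveI : IsOpenImmersion (specOfAlgebraMap R₁ R₂) := IsOpenImmersion.of_isLocalization (1 : R₁)
  -- `(𝒩 ×_R R₁) ×_{R₁} R₂ ≅ 𝒩 ×_R R₂` over `R₂`
  have heq : specOfAlgebraMap R₁ R₂ ≫ specOfAlgebraMap R R₁ = specOfAlgebraMap R R₂ := by
    simp only [specOfAlgebraMap, ← Spec.map_comp, ← CommRingCat.ofHom_comp,
      ← IsScalarTower.algebraMap_eq R R₁ R₂]
  exact (h.pullback_specOfAlgebraMap (R' := R₂)).of_iso_left
    (pullbackPullbackIso (specOfAlgebraMap R R₁) (specOfAlgebraMap R₁ R₂) 𝒩 ≪≫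
      Over.isoMk (pullback.congrHom rfl heq)
        ((pullback.lift_snd _ _ _).trans (Category.comp_id _)))

end IsSchematicNeronModel

end Transport

/-! ### Pushouts of schemes along open immersions: where the two charts land -/

section Pushout

variable {U A B : Scheme.{u}} (f : U ⟶ A) (g : U ⟶ B) [IsOpenImmersion f] [IsOpenImmersion g]

/-- A point of a pushout of schemes along open immersions lies in one of the two charts.
[folklore] -/
theorem exists_inl_or_inr_eq (x : ↑(pushout f g)) :
    (∃ y, pushout.inl f g y = x) ∨ ∃ z, pushout.inr f g z = x := by
  obtain ⟨i, xi, rfl⟩ := Scheme.IsLocallyDirected.ι_jointly_surjective (span f g) x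
  rcases i with (_ | _ | _)
  · left
    refine ⟨f xi, ?_⟩
    have hw : f ≫ pushout.inl f g = colimit.ι (span f g) none :=
      colimit.w (span f g) WalkingSpan.Hom.fst
    rw [← Scheme.Hom.comp_apply, hw]
    try rfl
  · left; exact ⟨xi, rfl⟩
  · right; exact ⟨xi, rfl⟩

variable {S : Scheme.{u}} (pa : A ⟶ S) (pb : B ⟶ S) (w : f ≫ pa = g ≫ pb)

/-- In a pushout `A ⨿_U B → S` of schemes along open immersions, the preimage of `V ⊆ S` is the
chart `A` as soon as `A` maps into `V` and the part of `B` over `V` comes from `U`. [folklore] -/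
theorem preimage_desc_eq_range_inl (V : Set S) (hA : ∀ y : A, pa y ∈ V)
    (hB : ∀ z : B, pb z ∈ V → z ∈ Set.range g) :
    pushout.desc pa pb w ⁻¹' V = Set.range (pushout.inl f g) := by
  ext x
  constructor
  · intro hx
    rcases exists_inl_or_inr_eq f g x with ⟨y, rfl⟩ | ⟨z, rfl⟩
    · exact ⟨y, rfl⟩
    · have hz : pb z ∈ V := by
        have : (pushout.inr f g ≫ pushout.desc pa pb w) z ∈ V := hx
        rwa [pushout.inr_desc] at this
      obtain ⟨v, rfl⟩ := hB z hz
      exact ⟨f v, congrFun (congrArg (fun k : U ⟶ pushout f g => (k : U → ↑(pushout f g)))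
        (pushout.condition (f := f) (g := g))) v⟩
  · rintro ⟨y, rfl⟩
    change (pushout.inl f g ≫ pushout.desc pa pb w) y ∈ V
    rw [pushout.inl_desc]
    exact hA y

/-- Symmetric version of `preimage_desc_eq_range_inl` for the second chart. [folklore] -/
theorem preimage_desc_eq_range_inr (V : Set S) (hB : ∀ z : B, pb z ∈ V)
    (hA : ∀ y : A, pa y ∈ V → y ∈ Set.range f) :
    pushout.desc pa pb w ⁻¹' V = Set.range (pushout.inr f g) := by
  ext x
  constructor
  · intro hx
    rcases exists_inl_or_inr_eq f g x with ⟨y, rfl⟩ | ⟨z, rfl⟩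
    · have hy : pa y ∈ V := by
        have : (pushout.inl f g ≫ pushout.desc pa pb w) y ∈ V := hx
        rwa [pushout.inl_desc] at this
      obtain ⟨v, rfl⟩ := hA y hy
      exact ⟨g v, (congrFun (congrArg (fun k : U ⟶ pushout f g => (k : U → ↑(pushout f g)))
        (pushout.condition (f := f) (g := g))) v).symm⟩
    · exact ⟨z, rfl⟩
  · rintro ⟨z, rfl⟩
    change (pushout.inr f g ≫ pushout.desc pa pb w) z ∈ V
    rw [pushout.inr_desc]
    exact hB z

end Pushout

/-! ### Ranges of localization maps -/

section Ranges

variable {R : Type u} [CommRing R]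

/-- The image of `Spec R' → Spec R` for a model `R'` of `R[1/x]` is `D(x)`. [folklore] -/
theorem range_specOfAlgebraMap (x : R) (R' : Type u) [CommRing R'] [Algebra R R']
    [IsLocalization.Away x R'] :
    Set.range (specOfAlgebraMap R R') = (PrimeSpectrum.basicOpen x : Set (PrimeSpectrum R)) :=
  PrimeSpectrum.localization_away_comap_range R' x

end Ranges

end Literature.NumberTheory.EllipticCurves

end
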